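import Summits.ResolutionOfSingularities.ResolutionOfSingularities.Theorems.HilbertSamuelEliminationSigmaMaxModificationsCorridor3WLadderStrataScope
import Summits.ResolutionOfSingularities.ResolutionOfSingularities.Theorems.HilbertSamuelEliminationSigmaMaxModificationsCorridor3ChainTowerOrigin
import Summits.ResolutionOfSingularities.ResolutionOfSingularities.Theorems.HilbertSamuelEliminationSigmaMaxModificationsCorridor3WLadderLocalPointBlowup
import Summits.ResolutionOfSingularities.ResolutionOfSingularities.Theorems.HilbertSamuelEliminationSigmaMaxModificationsCorridor3MovingCompactnessComposition
import Literature.AlgebraicGeometry.CossartJannsenSaito2020.BlowupTowerLocalizeTransfer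
import Literature.AlgebraicGeometry.Motives.AbelianVarietyIsogenyProofs
import Literature.AlgebraicGeometry.Dimension.FibreLocalRingDimension
import Literature.AlgebraicGeometry.Resolution.PermissibleCentres
import Mathlib.AlgebraicGeometry.Properties
import HarnessLib

/-!
# [OURS · L1 W4.2] Generic points of a moving lineage along a chain of canonical near steps: heights, hits, misses,
# and the local schemes `Spec 𝒪_{X_n,η_n}` (bricks for the transfer row (T) `MovingLineageLocalizesM`)
# (crux chain w42, line `w_ladder`; `--supports stmt-ResolutionOfSingularities-19249`, helper)

OURS (cell res-hironaka, slot W4.2, seat res-type-053 gen 9, object D3 «(T) TRANSFER ROW» of res-L1-w42-plan-1's W4.2 DEAL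
2026-08-27T07:34:07Z); NOT statements of H. Hironaka's manuscript [Hironaka2017] nor of [CossartJannsenSaito2020]. AI-drafted,
weaker than expert review. Sorry-free PROOF file (no new definition, no named fact, no binder).

THE SETTING. A chain `c : ℕ → MarkedStage` of canonical near steps every stage of which carries res-L1-w42-stub-4's cycle
invariant `Moving.CycleInv k R N ν (c n)` (finite type over `k`, reduced, `dim ≤ N`, `ν` never exceeded), and along it irreducible
components `Z n` of the strata `X_n(ν)` with GENERIC POINTS `η n`, `Z (n+1)` dominating `Z n` under lead-1's step projection
`chainProj n` (p505866) — the data of idea-2's `IsMovingLineage` (card H; landed by res-type-040 as `…LocalChainsDefs`), unbundled.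

CONTENTS (all PROVED). §1 HEIGHTS UNDER CLOSED MORPHISMS (Mathlib's specialization order of a scheme, `a ≤ b ↔ b ⤳ a`):
`height (f x) ≤ height x` for `f` universally closed (chains below `f x` lift along the specializing map `f`, tree
`Literature.AlgebraicGeometry.Motives.Order.exists_ltSeries_length_eq_of_fibration`), `+ 1` when a point `y ≠ x`, `x ⤳ y`, lies
in the fibre of `f x` (with tree `height_add_coheight_le_topologicalKrullDim`). §2 GENERIC POINTS OF COMPONENTS OF A REGULAR `V(C)`:
`C_η = 𝔪_η` (generic-point twin of lead-1's `Helpers.stalkIdeal_eq_maximalIdeal_of_isolated_of_isRegular`, p503609).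
§3 THE LOCAL SCHEME `Spec 𝒪_{X_n,η}` at the generic point of a stratum component under `CycleInv`: its closed point is ISOLATED
in the Hilbert–Samuel locus; excellent, reduced, `dim ≤ N − 1` when `Z` has a second point. §4 ALONG THE CHAIN:
`chainProj n (η (n+1)) = η n`; heights non-decreasing and bounded, hence eventually constant, and THEN `η (n+1)` is the only
point over `η n` which it specializes to («closed in its fibre», by §1 — no fibre-dimension formula); HIT (`Z n ⊆ supp C_n`)
⇒ `(C_n)_{η n} = 𝔪`; MISS ⇒ the stalk map of `chainProj n` at `η (n+1)` is an isomorphism.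

References: CJS LNM 2270 (2020) Lemma 6.30 and its proof via `X_η` (p. 97), Prop. 6.31, Rem. 6.29 (1), Thm. 2.33, Lemma 2.36,
Def. 2.35, p. 107 [CossartJannsenSaito2020]; Stacks Tags 02IZ, 0061, 00GU, 02OS [StacksProject].
-/

noncomputable section

set_option linter.dupNamespace false -- namespace `…Corridor3.Moving` re-enters `…Corridor3` (Moving files' convention)

open CategoryTheory CategoryTheory.Limits AlgebraicGeometry TopologicalSpace Topology IsLocalRing Order
open Summit.ResolutionOfSingularities.ResolutionOfSingularities.Theorems.CampaignW42
open Literature.AlgebraicGeometry.Resolution Literature.RingTheory.HilbertSamuel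
open Literature.AlgebraicGeometry.CossartJannsenSaito2020
open Summit.ResolutionOfSingularities.ResolutionOfSingularities.Theorems.SigmaMaxModificationsCorridor3
open Scheme.IdealSheafData

universe u

namespace Summit.ResolutionOfSingularities.ResolutionOfSingularities.Theorems.SigmaMaxModificationsCorridor3.Moving

/-! ## §1 Heights of points under universally closed morphisms -/

/-- **Chains of specializations below `f x` lift to chains below `x`** for a universally closed morphism (a closed map is
specializing, Mathlib `IsClosedMap.specializingMap`; chain lifting = the topological content of going up, Stacks 00GU):
`height (f x) ≤ height x` in the specialization orders. [cite: StacksProject, Tag 00GU] -/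
theorem height_base_le_height {X Y : Scheme.{u}} (f : X ⟶ Y) [UniversallyClosed f] (x : X) :
    height (f.base x) ≤ height x := by
  have hs : SpecializingMap f.base := f.isClosedMap.specializingMap
  have hfib : ∀ ⦃a : X⦄ ⦃b : Y⦄, b < f.base a → ∃ a' < a, f.base a' = b := by
    intro a b hb
    obtain ⟨a', ha', rfl⟩ := hs hb.le
    refine ⟨a', lt_of_le_not_ge ha' fun h => ?_, rfl⟩
    have hEq : a = a' := (Specializes.antisymm ha' h).eq
    subst hEq
    exact lt_irrefl _ hb
  refine height_le_iff'.mpr fun p hp => ?_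
  obtain ⟨q, hq, hqlast⟩ :=
    Literature.AlgebraicGeometry.Motives.Order.exists_ltSeries_length_eq_of_fibration f.base hfib p hp.symm
  rw [← hq]
  exact length_le_height hqlast.le

/-- **Strict form**: if moreover some `y ≠ x` with `x ⤳ y` lies in the fibre of `f x`, then `height (f x) + 1 ≤ height x`
(lift below `y`, then append `x`). [cite: StacksProject, Tag 00GU] -/
theorem height_base_add_one_le_height {X Y : Scheme.{u}} (f : X ⟶ Y) [UniversallyClosed f] {x y : X} (hxy : x ⤳ y)
    (hne : x ≠ y) (hfy : f.base y = f.base x) : height (f.base x) + 1 ≤ height x := by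
  have hlt : y < x := by
    refine lt_of_le_not_ge (Scheme.le_iff_specializes.mpr hxy) fun h => hne ?_
    exact (hxy.antisymm (Scheme.le_iff_specializes.mp h)).eq
  calc height (f.base x) + 1 = height (f.base y) + 1 := by rw [hfy]
    _ ≤ height y + 1 := add_le_add (height_base_le_height f y) le_rfl
    _ ≤ height x := height_add_one_le hlt

/-! ## §2 Generic points of the components of a (regular) closed subscheme -/

/-- **The local ring of `V(C)` at the generic point of one of its irreducible components has dimension `0`**, read on `W`:
`dim (𝒪_{W,η} ⧸ C_η) = 0` (`𝒪_{W,η}/C_η ≅ 𝒪_{V(C),z}` for the point `z` over `η`, which has no proper generization in `V(C)`: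
a generization `y ⤳ z` gives `closure {y} ⊇ Z` irreducible inside `supp C`, so `= Z` by maximality of the component).
[cite: StacksProject, Tag 02IZ] -/
theorem ringKrullDim_stalk_quot_stalkIdeal_eq_zero_of_isGenericPoint {W : Scheme.{u}} (C : W.IdealSheafData) {Z : Set W}
    (hZ : Z ∈ componentsIn (C.support : Set W)) {η : W} (hη : IsGenericPoint η Z) :
    ringKrullDim (W.presheaf.stalk η ⧸ stalkIdeal C η) = 0 := by
  have hηC : η ∈ (C.support : Set W) := componentsIn.subset hZ hη.mem
  have hrange : Set.range C.subschemeι.base = (C.support : Set W) := Scheme.IdealSheafData.range_subschemeι C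
  obtain ⟨z, hz⟩ : η ∈ Set.range C.subschemeι.base := hrange ▸ hηC
  have hsurj : Function.Surjective (C.subschemeι.stalkMap z).hom := C.subschemeι.stalkMap_surjective z
  have hker : RingHom.ker (C.subschemeι.stalkMap z).hom = stalkIdeal C (C.subschemeι.base z) := by
    rw [← stalkIdeal_ker_eq_ker_stalkMap C.subschemeι z, Scheme.IdealSheafData.ker_subschemeι]
  subst hz
  let e : (W.presheaf.stalk (C.subschemeι.base z) ⧸ stalkIdeal C (C.subschemeι.base z)) ≃+*
      C.subscheme.presheaf.stalk z :=
    (Ideal.quotEquivOfEq hker.symm).trans (RingHom.quotientKerEquivOfSurjective hsurj)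
  rw [e.ringKrullDim, ringKrullDim_stalk_eq_coheight]
  have hinj : Function.Injective C.subschemeι.base := C.subschemeι.isClosedEmbedding.injective
  have hmax : IsMax z := by
    intro y hy
    rw [AlgebraicGeometry.Scheme.le_iff_specializes] at hy
    -- `ι y ⤳ η`, `ι y ∈ supp C`
    have h1 : C.subschemeι.base y ⤳ C.subschemeι.base z := hy.map C.subschemeι.continuous
    have h2 : C.subschemeι.base y ∈ (C.support : Set W) := hrange ▸ ⟨y, rfl⟩
    have h3 : Z ⊆ closure {C.subschemeι.base y} := by
      rw [← hη.def]
      exact closure_minimal (Set.singleton_subset_iff.mpr (specializes_iff_mem_closure.mp h1)) isClosed_closure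
    have h4 : closure {C.subschemeι.base y} ⊆ (C.support : Set W) :=
      closure_minimal (Set.singleton_subset_iff.mpr h2) C.support.isClosed
    have h5 : closure {C.subschemeι.base y} ⊆ Z :=
      (mem_componentsIn_iff.mp hZ).2.2 _ h4 isIrreducible_singleton.closure h3
    have h6 : C.subschemeι.base z ⤳ C.subschemeι.base y :=
      hη.specializes (h5 (subset_closure (Set.mem_singleton _)))
    have h7 : C.subschemeι.base y = C.subschemeι.base z := (h1.antisymm h6).eq
    rw [hinj h7]
  rw [Order.coheight_eq_zero.mpr hmax]
  rfl

/-- **At the generic point `η` of an irreducible component of a REGULAR closed subscheme `V(C)` the stalk ideal is the maximal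
ideal, `C_η = 𝔪_η`**: `𝒪_{W,η}/C_η` is a regular local ring of dimension `0`, hence a field (CJS, proof of Lemma 6.30: on the
localisation `X_η` of a permissible `D ∋ η` «`D_η = η`», p. 97). [cite: CossartJannsenSaito2020, Lemma 6.30] -/
theorem stalkIdeal_eq_maximalIdeal_of_isGenericPoint_of_isRegular {W : Scheme.{u}} (C : W.IdealSheafData)
    (hreg : Literature.AlgebraicGeometry.Resolution.Scheme.IsRegular C.subscheme) {Z : Set W}
    (hZ : Z ∈ componentsIn (C.support : Set W)) {η : W} (hη : IsGenericPoint η Z) :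
    stalkIdeal C η = maximalIdeal (W.presheaf.stalk η) := by
  have hηC : η ∈ (C.support : Set W) := componentsIn.subset hZ hη.mem
  have hrange : Set.range C.subschemeι.base = (C.support : Set W) := Scheme.IdealSheafData.range_subschemeι C
  obtain ⟨z, hz⟩ : η ∈ Set.range C.subschemeι.base := hrange ▸ hηC
  have hdim := ringKrullDim_stalk_quot_stalkIdeal_eq_zero_of_isGenericPoint C hZ hη
  subst hz
  haveI hregq : IsRegularLocalRing (W.presheaf.stalk (C.subschemeι.base z) ⧸ stalkIdeal C (C.subschemeι.base z)) :=
    (isRegularLocalRing_stalk_subscheme_iff C z).mp (hreg z)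
  haveI : IsDomain (W.presheaf.stalk (C.subschemeι.base z) ⧸ stalkIdeal C (C.subschemeι.base z)) :=
    isDomain_of_isRegularLocalRing _
  haveI : Ring.KrullDimLE 0 (W.presheaf.stalk (C.subschemeι.base z) ⧸ stalkIdeal C (C.subschemeι.base z)) := by
    rw [Ring.krullDimLE_iff, hdim]; rfl
  have hfield : IsField (W.presheaf.stalk (C.subschemeι.base z) ⧸ stalkIdeal C (C.subschemeι.base z)) :=
    Ring.KrullDimLE.isField_of_isDomain
  exact IsLocalRing.eq_maximalIdeal (Ideal.Quotient.maximal_of_isField _ hfield)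

/-- A closed irreducible component of a closed set containing an irreducible closed set `Z` which is a component of a LARGER
closed set is `Z`: if `Z ∈ componentsIn S`, `T ⊆ S` and `Z ⊆ T`, then `Z ∈ componentsIn T`. [folklore] -/
theorem mem_componentsIn_of_subset {X : Type u} [TopologicalSpace X] {S T Z : Set X} (hZ : Z ∈ componentsIn S) (hTS : T ⊆ S)
    (hZT : Z ⊆ T) : Z ∈ componentsIn T := by
  rw [mem_componentsIn_iff] at hZ ⊢
  exact ⟨hZT, hZ.2.1, fun T' hT'T hT' hZT' => hZ.2.2 T' (hT'T.trans hTS) hT' hZT'⟩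


/-- **The projection of a dominating irreducible closed set maps generic point to generic point**: if
`closure (f '' Z') = Z`, then `f (η_{Z'}) = η_Z`. [cite: StacksProject, Tag 0061] -/
theorem base_eq_of_isGenericPoint_of_closure_image_eq {X Y : Scheme.{u}} (f : X ⟶ Y) {Z' : Set X} {Z : Set Y}
    (hdom : closure (f.base '' Z') = Z) {η' : X} (hη' : IsGenericPoint η' Z') {η : Y} (hη : IsGenericPoint η Z) :
    f.base η' = η := by
  have h := hη'.image f.continuous
  rw [hdom] at h
  exact h.eq hη

/-! ## §3 The local scheme at the generic point of a stratum component, under the cycle invariant -/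

section Stage

variable {R : ∀ S : Scheme.{u}, CentreSeq S → Prop} {N : ℕ} {ν : ℕ → ℕ} {k : Type u} [Field k] {s : MarkedStage.{u}}

/-- **`H^N` does not decrease under specialization** on a stage carrying the cycle invariant: `y ⤳ z ⟹ H(y) ≤ H(z)` (every
`X_n(≥ μ)` is closed, `CycleInv.isClosed_hsStratumGE`; CJS Thm. 2.33 / Lemma 2.36). [cite: CossartJannsenSaito2020, Thm. 2.33, Lemma 2.36] -/
theorem CycleInv.hsFun_le_hsFun_of_specializes (h : CycleInv k R N ν s) {y z : s.W} (hyz : y ⤳ z) :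
    Scheme.hsFun s.W N y ≤ Scheme.hsFun s.W N z := by
  haveI := s.ln
  have hcl : IsClosed (Scheme.hsStratumGE s.W N (Scheme.hsFun s.W N y)) := h.isClosed_hsStratumGE _
  have hy : y ∈ Scheme.hsStratumGE s.W N (Scheme.hsFun s.W N y) := Scheme.mem_hsStratumGE_iff.mpr le_rfl
  have hz : z ∈ Scheme.hsStratumGE s.W N (Scheme.hsFun s.W N y) :=
    closure_minimal (Set.singleton_subset_iff.mpr hy) hcl (specializes_iff_mem_closure.mp hyz)
  exact Scheme.mem_hsStratumGE_iff.mp hz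

/-- **A generization of a point of `X_n(ν)` which lies in `X_n(ν)` and generizes the generic point `η` of a COMPONENT `Z` of
`X_n(ν)` is `η`**: `closure {g} ⊇ Z` is irreducible inside the (closed) stratum, so equals `Z` by maximality of the component.
[cite: CossartJannsenSaito2020, Lemma 2.36] -/
theorem CycleInv.eq_of_specializes_of_mem_hsStratum (h : CycleInv k R N ν s) {Z : Set s.W}
    (hZ : Z ∈ componentsIn (Scheme.hsStratum s.W N ν)) {η : s.W} (hη : IsGenericPoint η Z) {g : s.W} (hg : g ⤳ η)
    (hgν : g ∈ Scheme.hsStratum s.W N ν) : g = η := by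
  haveI := s.ln
  have h3 : Z ⊆ closure {g} := by
    rw [← hη.def]
    exact closure_minimal (Set.singleton_subset_iff.mpr (specializes_iff_mem_closure.mp hg)) isClosed_closure
  have h4 : closure {g} ⊆ Scheme.hsStratum s.W N ν :=
    closure_minimal (Set.singleton_subset_iff.mpr hgν) h.isClosed_hsStratum
  have h5 : closure {g} ⊆ Z := (mem_componentsIn_iff.mp hZ).2.2 _ h4 isIrreducible_singleton.closure h3
  exact (hg.antisymm (hη.specializes (h5 (subset_closure (Set.mem_singleton g))))).eq

/-- **THE CLOSED POINT OF `Spec 𝒪_{X_n,η}` IS ISOLATED IN ITS HILBERT–SAMUEL LOCUS** for `η` the generic point of a component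
`Z` of `X_n(ν)` (stage under the cycle invariant): a point of the local scheme is a generization `g ⤳ η`, so `H(g) ≤ H(η) = ν`,
and `H(g) = ν` forces `g = η` (`eq_of_specializes_of_mem_hsStratum`); hence `ν` is the unique maximal value on the local scheme
and its locus is the closed point (CJS, proof of Lemma 6.30: «`U_η` is the Σ^max-locus of `X_η`», p. 97).
[cite: CossartJannsenSaito2020, Lemma 6.30, Def. 13.3] -/
theorem CycleInv.isIsolatedInHSMaxLocus_closedPoint_of_isGenericPoint (h : CycleInv k R N ν s) {Z : Set s.W}
    (hZ : Z ∈ componentsIn (Scheme.hsStratum s.W N ν)) {η : s.W} (hη : IsGenericPoint η Z) :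
    @IsIsolatedInHSMaxLocus (Spec (s.W.presheaf.stalk η)) (by haveI := s.ln; infer_instance) N
      (closedPoint (s.W.presheaf.stalk η)) := by
  haveI := s.ln
  set ι := s.W.fromSpecStalk η with hι
  have hH : ∀ t, Scheme.hsFun (Spec (s.W.presheaf.stalk η)) N t = Scheme.hsFun s.W N (ι.base t) :=
    fun t => Scheme.hsFun_fromSpecStalk s.W η N t
  have hιc : ι.base (closedPoint (s.W.presheaf.stalk η)) = η := Scheme.fromSpecStalk_closedPoint
  have hgen : ∀ t, ι.base t ⤳ η := fun t => by
    have ht : ι.base t ∈ Set.range ι.base := ⟨t, rfl⟩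
    rw [hι, Scheme.range_fromSpecStalk] at ht
    exact ht
  have hην : Scheme.hsFun s.W N η = ν := Scheme.mem_hsStratum_iff.mp (componentsIn.subset hZ hη.mem)
  -- every value on the local scheme is `≤ ν`, and `= ν` only at the closed point
  have hle : ∀ t, Scheme.hsFun (Spec (s.W.presheaf.stalk η)) N t ≤ ν := fun t => by
    rw [hH, ← hην]
    exact h.hsFun_le_hsFun_of_specializes (hgen t)
  have heq : ∀ t, Scheme.hsFun (Spec (s.W.presheaf.stalk η)) N t = ν → t = closedPoint (s.W.presheaf.stalk η) := by
    intro t ht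
    rw [hH] at ht
    have hg : ι.base t = η := h.eq_of_specializes_of_mem_hsStratum hZ hη (hgen t) (Scheme.mem_hsStratum_iff.mpr ht)
    exact ι.isEmbedding.injective (hg.trans hιc.symm)
  have hclosedν : Scheme.hsFun (Spec (s.W.presheaf.stalk η)) N (closedPoint (s.W.presheaf.stalk η)) = ν := by
    rw [hH, hιc, hην]
  refine ⟨Set.univ, isOpen_univ, ?_⟩
  ext t
  simp only [Set.mem_inter_iff, Set.mem_univ, true_and, Set.mem_singleton_iff, Scheme.mem_hsMaxLocus_iff]
  constructor
  · intro hmax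
    apply heq
    exact le_antisymm (hle t) (hclosedν ▸ hmax.2 ⟨closedPoint _, rfl⟩ (hclosedν.symm ▸ hle t))
  · rintro rfl
    rw [hclosedν]
    exact ⟨⟨closedPoint _, hclosedν⟩, fun μ ⟨t, ht⟩ _ => ht ▸ hle t⟩

/-- **`dim Spec 𝒪_{X_n,η} ≤ d`** for the generic point `η` of a closed irreducible `Z` with a second point, on a stage of dimension
`≤ d + 1`: `dim 𝒪_{X_n,η} = coheight η`, `height η ≥ 1`, `height + coheight ≤ dim`. [cite: StacksProject, Tag 02IZ] -/
theorem topologicalKrullDim_Spec_stalk_le_of_isGenericPoint {W : Scheme.{u}} {Z : Set W} {η : W} (hη : IsGenericPoint η Z)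
    {y : W} (hy : y ∈ Z) (hne : y ≠ η) {d : ℕ} (hdim : topologicalKrullDim W ≤ (d + 1 : ℕ)) :
    topologicalKrullDim ↥(Spec (W.presheaf.stalk η)) ≤ (d : WithBot ℕ∞) := by
  have hηy : η ⤳ y := hη.specializes hy
  have hlt : y < η := by
    refine lt_of_le_not_ge (Scheme.le_iff_specializes.mpr hηy) fun h => hne ?_
    exact ((Scheme.le_iff_specializes.mp h).antisymm hηy).eq
  have h1 : (1 : ℕ∞) ≤ height η := by
    have := height_add_one_le hlt
    exact le_trans (by simp) this
  have hsum : height η + coheight η ≤ ((d + 1 : ℕ) : ℕ∞) := by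
    have := (Literature.AlgebraicGeometry.Dimension.height_add_coheight_le_topologicalKrullDim η).trans hdim
    exact_mod_cast this
  have hco : coheight η ≤ (d : ℕ∞) := by
    have h2 : coheight η + 1 ≤ (d : ℕ∞) + 1 := by
      calc coheight η + 1 ≤ coheight η + height η := add_le_add le_rfl h1
        _ = height η + coheight η := add_comm _ _
        _ ≤ ((d + 1 : ℕ) : ℕ∞) := hsum
        _ = (d : ℕ∞) + 1 := by push_cast; ring
    exact WithTop.le_of_add_le_add_right WithTop.one_ne_top h2
  have hring : ringKrullDim (W.presheaf.stalk η) ≤ (d : WithBot ℕ∞) := by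
    rw [AlgebraicGeometry.ringKrullDim_stalk_eq_coheight]
    exact_mod_cast hco
  have : topologicalKrullDim ↥(Spec (W.presheaf.stalk η)) = ringKrullDim (W.presheaf.stalk η) :=
    PrimeSpectrum.topologicalKrullDim_eq_ringKrullDim (W.presheaf.stalk η)
  rw [this]
  exact hring

/-- `Spec 𝒪_{X_n,η}` is excellent (stages under the cycle invariant are of finite type over a field; Matsumura §32).
[cite: Matsumura1987, §32 p. 260] -/
theorem CycleInv.isExcellent_Spec_stalk (h : CycleInv k R N ν s) (η : s.W) :
    Scheme.IsExcellent (Spec (s.W.presheaf.stalk η)) :=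
  Scheme.isExcellent_Spec_of_isExcellentRing _ (isExcellentRing_stalk_of_isExcellent h.isExcellent η)

/-- `Spec 𝒪_{X_n,η}` is reduced (the stage is). [folklore] -/
theorem CycleInv.isReduced_Spec_stalk (h : CycleInv k R N ν s) (η : s.W) : IsReduced (Spec (s.W.presheaf.stalk η)) := by
  haveI := h.isReduced
  infer_instance

end Stage

/-! ## §4 Along the chain: generic points of a lineage, heights, hits and misses -/

section Chain

variable {R : ∀ S : Scheme.{u}, CentreSeq S → Prop} {N : ℕ} {ν : ℕ → ℕ} {k : Type u} [Field k]
  {c : ℕ → MarkedStage.{u}} (hstep : ∀ n, CanonicalNearStep R N ν (c n) (c (n + 1)))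

/-- The step projection of a chain is proper, in particular universally closed. [cite: GortzWedhorn2020, Prop. 13.96 (1)] -/
theorem universallyClosed_chainProj (n : ℕ) : UniversallyClosed (Helpers.chainProj hstep n) := by
  haveI := (c n).ln
  haveI : IsProper (Helpers.chainProj hstep n) := (Helpers.isBlowup_chainProj hstep n).isProper
  infer_instance

/-- **Generic point over generic point**: for a lineage (`closure (π_n '' Z (n+1)) = Z n`) the projection maps `η (n+1) ↦ η n`.
[cite: CossartJannsenSaito2020, Rem. 6.29 (1)] -/
theorem chainProj_base_genericPoint {Z : ∀ n, Set (c n).W} {η : ∀ n, (c n).W} (hη : ∀ n, IsGenericPoint (η n) (Z n))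
    (hdom : ∀ n, closure ((Helpers.chainProj hstep n).base '' Z (n + 1)) = Z n) (n : ℕ) :
    (Helpers.chainProj hstep n).base (η (n + 1)) = η n :=
  base_eq_of_isGenericPoint_of_closure_image_eq _ (hdom n) (hη (n + 1)) (hη n)

/-- **The heights of the generic points of a lineage are non-decreasing** along the chain. [cite: StacksProject, Tag 00GU] -/
theorem height_genericPoint_mono {Z : ∀ n, Set (c n).W} {η : ∀ n, (c n).W} (hη : ∀ n, IsGenericPoint (η n) (Z n))
    (hdom : ∀ n, closure ((Helpers.chainProj hstep n).base '' Z (n + 1)) = Z n) (n : ℕ) :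
    height (η n) ≤ height (η (n + 1)) := by
  haveI := universallyClosed_chainProj hstep n
  rw [← chainProj_base_genericPoint hstep hη hdom n]
  exact height_base_le_height _ _

/-- The heights of the generic points are bounded by the level on stages under the cycle invariant (`dim X_n ≤ N`).
[cite: StacksProject, Tag 0061] -/
theorem height_genericPoint_le (hinv : ∀ n, CycleInv k R N ν (c n)) (η : ∀ n, (c n).W) (n : ℕ) :
    height (η n) ≤ (N : ℕ∞) := by
  have h1 := Literature.AlgebraicGeometry.Dimension.height_add_coheight_le_topologicalKrullDim (η n)
  have h2 : ((height (η n) + coheight (η n) : ℕ∞) : WithBot ℕ∞) ≤ (N : WithBot ℕ∞) := h1.trans (hinv n).dim_le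
  have h3 : height (η n) + coheight (η n) ≤ (N : ℕ∞) := by exact_mod_cast h2
  exact le_trans le_self_add h3

/-- **THE HEIGHTS ARE EVENTUALLY CONSTANT, AND THEN `η (n+1)` IS THE ONLY POINT OF ITS FIBRE OVER `η n` WHICH IT SPECIALIZES TO**
(«the generic point of the lineage is closed in its fibre» — the clause res-L1-w42-idea-2 flagged; here by chain lifting, §1):
there is `n₀` such that for `n ≥ n₀`, every `y` with `η (n+1) ⤳ y` and `π_n y = η n` equals `η (n+1)`.
[cite: CossartJannsenSaito2020, Lemma 6.30] -/
theorem exists_forall_eq_genericPoint_of_specializes (hinv : ∀ n, CycleInv k R N ν (c n)) {Z : ∀ n, Set (c n).W}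
    {η : ∀ n, (c n).W} (hη : ∀ n, IsGenericPoint (η n) (Z n))
    (hdom : ∀ n, closure ((Helpers.chainProj hstep n).base '' Z (n + 1)) = Z n) :
    ∃ n₀, ∀ n, n₀ ≤ n → ∀ y : (c (n + 1)).W, η (n + 1) ⤳ y → (Helpers.chainProj hstep n).base y = η n → y = η (n + 1) := by
  -- the heights as natural numbers
  have hfin : ∀ n, height (η n) ≠ ⊤ := fun n =>
    ne_top_of_le_ne_top (ENat.coe_ne_top N) (height_genericPoint_le hinv η n)
  let d : ℕ → ℕ := fun n => (height (η n)).toNat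
  have hd : ∀ n, (d n : ℕ∞) = height (η n) := fun n => ENat.coe_toNat (hfin n)
  have hmono : Monotone d := by
    refine monotone_nat_of_le_succ fun n => ?_
    have := height_genericPoint_mono hstep hη hdom n
    rw [← hd n, ← hd (n + 1)] at this
    exact_mod_cast this
  have hbdd : ∀ n, d n ≤ N := fun n => by
    have := height_genericPoint_le hinv η n
    rw [← hd n] at this
    exact_mod_cast this
  obtain ⟨j, n₀, hj⟩ := Cruxes.SigmaMaxModifications.MovingCompactnessLine.eventually_const_of_monotone_of_bounded hmono hbdd
  refine ⟨n₀, fun n hn y hy hfy => ?_⟩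
  by_contra hne
  haveI := universallyClosed_chainProj hstep n
  have hstrict := height_base_add_one_le_height (Helpers.chainProj hstep n) hy (Ne.symm hne)
    (hfy.trans (chainProj_base_genericPoint hstep hη hdom n).symm)
  rw [chainProj_base_genericPoint hstep hη hdom n, ← hd n, ← hd (n + 1), hj n hn,
    hj (n + 1) (Nat.le_succ_of_le hn)] at hstrict
  have : (j : ℕ∞) + 1 ≤ (j : ℕ∞) := hstrict
  exact absurd this (by exact_mod_cast Nat.not_succ_le_self j)

/-- **AT A HIT THE CENTRE'S STALK AT THE GENERIC POINT IS THE MAXIMAL IDEAL**: if the component `Z n` of `X_n(ν)` lies in the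
centre `C_n` of the step (which is regular and inside `X_n(ν)` under the cycle invariant), then `(C_n)_{η n} = 𝔪_{η n}` — locally
at `η n` the step is the blow-up of the closed point of `Spec 𝒪_{X_n,η_n}` (CJS, proof of Lemma 6.30, «`D_η = η`», p. 97).
[cite: CossartJannsenSaito2020, Lemma 6.30] -/
theorem stalkIdeal_chainCentre_eq_maximalIdeal_of_subset (hRa : OracleAdmissible R) (hν : ν ≠ iterPSum N Phi) {n : ℕ}
    (hinv : CycleInv k R N ν (c n)) {Z : Set (c n).W} (hZ : Z ∈ componentsIn (Scheme.hsStratum (c n).W N ν))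
    {η : (c n).W} (hη : IsGenericPoint η Z) (hZC : Z ⊆ ((Helpers.chainCentre hstep n).support : Set (c n).W)) :
    stalkIdeal (Helpers.chainCentre hstep n) η = maximalIdeal ((c n).W.presheaf.stalk η) := by
  obtain ⟨P', hcs⟩ := Helpers.isCanonicalStep_chainCentre hstep n
  obtain ⟨hreg, hsub, -, -⟩ := hinv.centre hRa hν hcs
  exact stalkIdeal_eq_maximalIdeal_of_isGenericPoint_of_isRegular _ hreg (mem_componentsIn_of_subset hZ hsub hZC) hη

/-- Under the cycle invariant the chain's centres are radical: `C_n = 𝓘(V(C_n))`. [folklore] -/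
theorem chainCentre_eq_vanishingIdeal_support' (hRa : OracleAdmissible R) (hν : ν ≠ iterPSum N Phi) {n : ℕ}
    (hinv : CycleInv k R N ν (c n)) :
    Helpers.chainCentre hstep n = vanishingIdeal (Helpers.chainCentre hstep n).support := by
  obtain ⟨P', hcs⟩ := Helpers.isCanonicalStep_chainCentre hstep n
  exact Helpers.eq_vanishingIdeal_support_of_isRegular_subscheme _ (hinv.centre hRa hν hcs).1

/-- **A hit is decided at the generic point**: `Z n ⊆ supp C_n ↔ η n ∈ supp C_n`. [folklore] -/
theorem subset_support_iff_genericPoint_mem {n : ℕ} {Z : Set (c n).W} {η : (c n).W} (hη : IsGenericPoint η Z)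
    (C : (c n).W.IdealSheafData) : Z ⊆ (C.support : Set (c n).W) ↔ η ∈ (C.support : Set (c n).W) :=
  ⟨fun h => h hη.mem, fun h => (hη.mem_closed_set_iff C.support.isClosed).mp h⟩

/-- **AT A MISS THE STEP IS A LOCAL ISOMORPHISM AT THE GENERIC POINT**: if `η n ∉ supp C_n` then the stalk map of `π_n` at
`η (n+1)` is an isomorphism (a blow-up is an isomorphism off its centre, Stacks 02OS). [cite: StacksProject, Tag 02OS] -/
theorem isIso_stalkMap_chainProj_of_notMem {n : ℕ} {y : (c (n + 1)).W}
    (hy : (Helpers.chainProj hstep n).base y ∉ ((Helpers.chainCentre hstep n).support : Set (c n).W)) :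
    IsIso ((Helpers.chainProj hstep n).stalkMap y) := by
  haveI := (Helpers.isBlowup_chainProj hstep n).isIso_compl
  exact isIso_stalkMap_of_isIso_morphismRestrict (Helpers.chainProj hstep n)
    ⟨((Helpers.chainCentre hstep n).support : Set (c n).W)ᶜ, (Helpers.chainCentre hstep n).support.isClosed.isOpen_compl⟩ y hy

end Chain

end Summit.ResolutionOfSingularities.ResolutionOfSingularities.Theorems.SigmaMaxModificationsCorridor3.Moving

end
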